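import Literature.AlgebraicGeometry.Frobenioids.ArithmeticRealificationFractionalPart
import Literature.AlgebraicGeometry.Frobenioids.ArithmeticFrobenioidModel
import Literature.AlgebraicGeometry.Frobenioids.ModelFrobenioidMap
import Literature.AlgebraicGeometry.Frobenioids.RealificationDataCanonical
import HarnessLib

/-!
# Frobenioids I, Cor. 5.4 at `C_{K/F}` (row C54-core-arith, sub-row (4), input (D1)): small identity-base
# linear morphisms of THE realification with prescribed unit coordinate

Mochizuki, *The geometry of Frobenioids I: the general theory*, Kyushu J. Math. **62** (2008) 293–400,
Cor. 5.4 p. 104 (rigidity / 1-uniqueness of `Ψ^rlf`; "by a similar argument applied to prove the rigidity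
assertion in Corollary 4.11, (i), (iv)", p. 104 l. 22–24), at THE realification (Prop. 5.3 p. 103, the model
Frobenioid of `(Φ^rlf, ℝ·Φ^birat)`, Thm. 5.2 (i) p. 100) of the arithmetic Frobenioid `C_{K/F}` of Ex. 6.3 /
Thm. 6.4 p. 113–115. [cite: MochizukiFrdI2008, Cor. 5.4 p.104] [cite: MochizukiFrdI2008, Thm. 5.2(i) p.100]
[cite: MochizukiFrdI2008, Prop. 5.3 p.103]

PROOF-ONLY (cell abc-iut, seat abc-iut-L1-d2; L1-lead R124–R126: input (D1) of the final data-level file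
`Cor54RigidityArithMorphisms` of seat abc-iut-w5-d227, in the letter that seat asked for, STATUS 07:45:22Z).
Setting of `Cor54RigidityArithDegreeBase` (seat abc-iut-L1-d8): `D = FinSubextCat F K`, `Φ = arithDivisorFunctor F K`
(objectwise perf-factorial, `hΦ'`), THE realification data `R = RealificationData.canonical Φ hΦ'`, a subfunctor of
groups `Ψ ⊆ Φ^gp` (e.g. `Φ^birat`), `G = (R.ofBaseData Ψ).functor : (Φ, Ψ)-model → (Φ^rlf, ℝ·Ψ)-model`
(`= C_{K/F}^un-tr → C_{K/F}^rlf` for `Ψ = Φ^birat`).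

* **`FrdI.Cor54Sub.exists_small_linear_arith`** — for every `X = Spec L` and every `U ∈ (ℝ·Ψ)(X)` there is ONE
  `S ∈ Φ(X)` such that for EVERY `n ∈ ℤ` there is an identity-base linear morphism
  `k = (1, 𝟙_X, z, Uⁿ) : G(X, 0) → G(X, γ')` of THE realification between `G`-IMAGE objects whose zero divisor
  is small: `z · e = ι(S)` in `Φ^rlf(X)` for some `e` (`ι = (Φ → Φ^rlf)_X`).  This is the integral/fractional-part
  decomposition `ArithRlfCoord.exists_fractionalPart` (seat file `ArithmeticRealificationFractionalPart`) packaged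
  as relation (d) of Thm. 5.2 (i): `0 + z = γ' + Div(Uⁿ)` in `(Φ^rlf)^gp(X)` with `γ' ∈ ι^gp(Φ(X)^gp)` minus the
  integral part and `z` the fractional part of `Uⁿ`.
Nothing here bears on [IUTchIII] Cor. 3.12; no side taken.
-/

noncomputable section

namespace Literature.AlgebraicGeometry.Frobenioids

namespace FrdI.Cor54Sub

open CategoryTheory Opposite NumberField IsDedekindDomain Literature.IUT.LogVolume ModelFrobenioid

variable {F : Type} [Field F] [NumberField F] {K : Type} [Field K] [Algebra F K]

/-- **(D1) at `C_{K/F}`: small identity-base linear morphisms with prescribed unit, uniformly in powers.**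
For `U ∈ (ℝ·Ψ)(X)` there is `S ∈ Φ(X)` such that for every `n ∈ ℤ` there are `γ' ∈ Φ(X)^gp`, a morphism
`k : G(X, 0) → G(X, γ')` of THE realification with `deg_Fr(k) = 1`, `Base(k) = 𝟙_X`, `Div(k) = z`,
`u_k = Uⁿ`, and `e ∈ Φ^rlf(X)` with `z · e = ι(S)`. [cite: MochizukiFrdI2008, Cor. 5.4 p.104] -/
theorem exists_small_linear_arith
    (hΦ' : ∀ X : (FinSubextCat F K)ᵒᵖ, IsPerfFactorial ((arithDivisorFunctor F K).obj X))
    (Ψ : GpSubfunctor (arithDivisorFunctor F K)) (X : FinSubextCat F K)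
    (U : ((RealificationData.canonical _ hΦ').realSpan Ψ).carrier X) :
    ∃ S : (arithDivisorFunctor F K).obj (op X), ∀ n : ℤ,
      ∃ (γ' : Algebra.GrothendieckGroup ((arithDivisorFunctor F K).obj (op X)))
        (k : ((RealificationData.canonical _ hΦ').ofBaseData Ψ).functor.obj ⟨X, 1⟩ ⟶
          ((RealificationData.canonical _ hΦ').ofBaseData Ψ).functor.obj ⟨X, γ'⟩)
        (z e : (RealificationData.canonical _ hΦ').rlf.obj (op X)),
        degFr k = 1 ∧ baseMap k = 𝟙 X ∧ div k = z ∧ unit k = U ^ n ∧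
          z * e = ((RealificationData.canonical _ hΦ').toRlf.app (op X)).hom S := by
  -- `Φ(L)` is perf-factorial, `L = X.L`
  have hM : IsPerfFactorial (Multiplicative (EffArithDivisor X.L)) := hΦ' (op X)
  -- the decomposition for `ι' := (Φ → Φ^rlf)_X` (pointwise `rfl`-equal to `ι`) at `ξ := U`
  obtain ⟨S, hS⟩ := ArithRlfCoord.exists_fractionalPart_of_eq hM
    ((RealificationData.canonical _ hΦ').toRlf.app (op X)).hom (fun _ => rfl)
    (U : Algebra.GrothendieckGroup ((RealificationData.canonical _ hΦ').rlf.obj (op X)))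
  refine ⟨S, fun n => ?_⟩
  obtain ⟨z, g, hz, e, he⟩ := hS n
  refine ⟨g, ⟨1, 𝟙 X, z, U ^ n, ?_⟩, z, e, rfl, rfl, rfl, rfl, he.symm⟩
  -- relation (d): `η^gp(0)^1 · [z] = Φ^rlf(𝟙)(η^gp γ') · Div(Uⁿ)` in `(Φ^rlf)^gp(X)`
  change gpApp ((RealificationData.canonical (arithDivisorFunctor F K) hΦ').ofBaseData Ψ).η (op X) 1 ^
        ((1 : ℕ+) : ℕ) * _ =
      pullGp (RealificationData.canonical (arithDivisorFunctor F K) hΦ').rlf (𝟙 X)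
          (gpApp ((RealificationData.canonical (arithDivisorFunctor F K) hΦ').ofBaseData Ψ).η (op X) g) *
        divB (RealificationData.canonical (arithDivisorFunctor F K) hΦ').rlf
          ((RealificationData.canonical (arithDivisorFunctor F K) hΦ').realSpan Ψ).toMonoid
          ((RealificationData.canonical (arithDivisorFunctor F K) hΦ').realSpan Ψ).incl (op X) (U ^ n)
  rw [PNat.one_coe, pow_one, map_one, one_mul, pullGp_id]
  -- `η^gp = MonGp.map ι'` and `Div_{ℝ·Ψ}(Uⁿ) = (U : (Φ^rlf)^gp(X))ⁿ` hold by `rfl`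
  exact hz.trans (by congr 1)

end FrdI.Cor54Sub

end Literature.AlgebraicGeometry.Frobenioids

end
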